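import Literature.NumberTheory.EllipticCurves.Kramer1981.SplitMultiplicativeNormIndexProofs
import Literature.NumberTheory.DiophantineGeometry.LocalReductionProofs
import Literature.NumberTheory.GaloisRepresentations.LocalWeilDatumRelative
import Literature.NumberTheory.GaloisRepresentations.LocalWeilDatumValuation
import HarnessLib

/-!
# Kramer 1981, §2: preliminaries for Proposition 2 (a) — the twisted Tate curve over an
unramified quadratic extension

Kenneth Kramer, *Arithmetic of elliptic curves upon quadratic extension*, Trans. Amer. Math.
Soc. 264 (1981), 121–135, §2 "The cokernel of the local norm", Proposition 2 (p. 123): "Suppose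
that `E` is a twisted Tate curve, twisted by the unramified quadratic extension `L`. (a) If `K` is
unramified over `F`, then `i(K/F)` is `0` or `1` according to whether `v(Δ)` is odd or even."

This file proves, for a non-archimedean local field `F` of characteristic `0`, an elliptic curve
`E/F` whose minimal model has multiplicative reduction, and an unramified quadratic
`K' = F(x) ⊆ F̄`, `x² = d`, the field-theoretic inputs of Kramer's argument (all theorems, no new
definitions or named facts):

* `exists_tateParameter_of_minimal_hasMultiplicativeReduction`: the Tate parameter `q` with
  `j(E_q) = j(E)`, `|q| = |j(E)|⁻¹` (Silverman ATAEC V.5.3 with AEC VII.5.1 (b), from the tree's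
  discharged `isomorphic_tateCurve_of_one_lt_norm_j_holds`);
* `not_isSquare_gamma_of_not_hasSplitMultiplicativeReduction`: non-split multiplicative reduction
  forces `γ(E/F) = -c₄/c₆ ∉ F^{×2}` (ATAEC V.5.3 (b));
* `sqrt_gamma_mem_maxUnramified`: the inertia group fixes `√γ`, i.e. `F(√γ)/F` is unramified —
  "`E` is a twisted Tate curve, twisted by the UNRAMIFIED quadratic extension `L = F(√γ)`"
  (ATAEC V.5.3 with Ex. 5.11; both residue characteristics, the dyadic case through
  `-c₄c₆ = a₁^{10} + 4(…)` on an integral minimal model);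
* `mem_of_sq_eq_of_mem_maxUnramified`, `isSquare_gamma_of_le_maxUnramified`: an unramified
  quadratic `K'` contains every square root in `F_nr` of an element of `F`, so `γ ∈ K'^{×2}` and
  `E ≅ E_q` over `K'` ("`E` becomes isomorphic to `G_m/q^ℤ` over any field containing `L`",
  Kramer p. 123) — via the tree's Weil-group dictionary `K ↦ W_F ∩ G_K` (Tate, Corvallis (1.4.1),
  tree `LocalWeilDatum.le_of_fieldSubgroup_le`);
* `mem_quadraticNormSubgroup_iff_two_dvd_ord`: the norm group of the unramified quadratic
  extension is the group of units of even valuation (Serre, *Local Fields* V §2 Cor. to Prop. 3),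
  from `F_nr/F` unramified (tree `exists_algNorm_eq_zpow_of_mem_maxUnramified`) and the local
  class field theory index `[F^× : N K'^×] = 2` (tree `index_normSubgroup_eq_finrank_holds`).

## References
* [cite: Kramer1981, §2 Prop. 2 (p. 123)]
* [cite: SilvermanATAEC1994, Thm. V.5.3 and Ex. 5.11]
* [cite: SerreLocalFields1979, Ch. IV §4 and Ch. V §2]
* [cite: TateCorvallis1979, (1.4.1)]
-/

noncomputable section

open scoped Classical

open ValuativeRel Field WeierstrassCurve
open Literature.NumberTheory.GaloisRepresentations
open Literature.NumberTheory.GaloisRepresentations.IsNonarchimedeanLocalField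
open Literature.NumberTheory.EllipticCurves.TateCurve
open Literature.NumberTheory.EllipticCurves.SteinWuthrich2013
open Literature.NumberTheory.QuadraticForms
open Literature.NumberTheory.EllipticCurves.KramerTunnell1982

namespace Literature.NumberTheory.EllipticCurves.Kramer1981

universe u

/-! ## §1 Non-split multiplicative reduction: the Tate parameter and `γ ∉ F^{×2}` -/

section NonSplit

variable {F : Type} [Field F] [ValuativeRel F] [TopologicalSpace F] [IsNonarchimedeanLocalField F]
  [CharZero F]

omit [CharZero F] in
/-- `‖x‖ ≤ 1 ↔ x ∈ 𝒪[F]` in range form. [folklore] -/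
private theorem norm_le_one_iff_mem_range' :
    letI := nontriviallyNormedField F
    ∀ x : F, ‖x‖ ≤ 1 ↔ x ∈ Set.range (algebraMap 𝒪[F] F) := by
  letI := nontriviallyNormedField F
  intro x
  rw [norm_le_one_iff F x]
  constructor
  · intro hx; exact ⟨⟨x, hx⟩, rfl⟩
  · rintro ⟨y, rfl⟩; exact y.2

/-- `|j(E)| > 1` when the minimal model of `E` has multiplicative reduction (Silverman AEC
VII.5.1 (b), through the tree's discharged `one_lt_norm_j_of_hasMultiplicativeReduction_holds` and
`j(E_min) = j(E)`). [cite: SilvermanAEC2009, Prop. VII.5.1 (b)] -/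
theorem one_lt_norm_j_of_minimal_hasMultiplicativeReduction (E : WeierstrassCurve F) [E.IsElliptic]
    (hmult : (E.minimal 𝒪[F]).HasMultiplicativeReduction 𝒪[F]) :
    letI := nontriviallyNormedField F; 1 < ‖E.j‖ := by
  letI := nontriviallyNormedField F
  haveI : (E.minimal 𝒪[F]).IsElliptic := by
    change ((E.exists_isMinimal 𝒪[F]).choose • E).IsElliptic
    infer_instance
  have h := one_lt_norm_j_of_hasMultiplicativeReduction_holds 𝒪[F] norm_le_one_iff_mem_range'
    (E.minimal 𝒪[F]) hmult
  have hj : (E.minimal 𝒪[F]).j = E.j := by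
    change ((E.exists_isMinimal 𝒪[F]).choose • E).j = E.j
    exact variableChange_j _ _
  rwa [hj] at h

/-- **The Tate parameter of a curve with multiplicative reduction** (Silverman ATAEC V.5.3 (a)
with AEC VII.5.1 (b)): `q ∈ F`, `0 < |q| < 1`, `j(E_q) = j(E)`, `|q| = |j(E)|⁻¹` — Kramer p. 123:
"there is an element `q` in `F` … such that `E` is isomorphic to `G_m/q^ℤ`" (over `F̄`).
[cite: SilvermanATAEC1994, Thm. V.5.3 (a) (PDF p. 407)] -/
theorem exists_tateParameter_of_minimal_hasMultiplicativeReduction (E : WeierstrassCurve F)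
    [E.IsElliptic] (hmult : (E.minimal 𝒪[F]).HasMultiplicativeReduction 𝒪[F]) :
    letI := nontriviallyNormedField F
    ∃ q : F, q ≠ 0 ∧ ‖q‖ < 1 ∧ tateJ q = E.j ∧ ‖q‖ = ‖E.j‖⁻¹ := by
  letI := nontriviallyNormedField F
  have hj := one_lt_norm_j_of_minimal_hasMultiplicativeReduction E hmult
  obtain ⟨q, hq0, hq, hqj, -⟩ := isomorphic_tateCurve_of_one_lt_norm_j_holds E hj
  exact ⟨q, hq0, hq, hqj, norm_tateParameter_eq hq hqj⟩

/-- **Non-split multiplicative reduction forces `γ(E/F) = -c₄/c₆ ∉ F^{×2}`** (Silverman ATAEC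
V.5.3 (b) (iii) ⇒ (i) ⇒ (ii): `γ ∈ F^{×2}` gives `E ≅_F E_q`, which has split multiplicative
reduction; split-ness is shared by all minimal models, AEC VII.1.3 (b), tree
`hasSplitMultiplicativeReduction_iff_of_isMinimal_of_eq_smul`).
[cite: SilvermanATAEC1994, Thm. V.5.3 (b) (PDF pp. 407–408)] -/
theorem not_isSquare_gamma_of_not_hasSplitMultiplicativeReduction (E : WeierstrassCurve F)
    [E.IsElliptic] (hmult : (E.minimal 𝒪[F]).HasMultiplicativeReduction 𝒪[F])
    (hns : ¬ (E.minimal 𝒪[F]).HasSplitMultiplicativeReduction 𝒪[F]) :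
    ¬ IsSquare (-(E.c₄ / E.c₆)) := by
  letI := nontriviallyNormedField F
  intro hγ
  have hj := one_lt_norm_j_of_minimal_hasMultiplicativeReduction E hmult
  obtain ⟨q, hq0, hq, hqj, -⟩ := isomorphic_tateCurve_of_one_lt_norm_j_holds E hj
  obtain ⟨C, hC⟩ := iso_tateCurve_of_isSquare_gamma E hj hq0 hq hqj hγ
  have hsplit : (C • E).HasSplitMultiplicativeReduction 𝒪[F] := by
    rw [hC]; exact tateCurve_hasSplitMultiplicativeReduction 𝒪[F] norm_le_one_iff_mem_range' hq
  haveI : (C • E).IsMinimal 𝒪[F] := hsplit.toIsMinimal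
  haveI : (C • E).IsElliptic := by infer_instance
  have hrel : E.minimal 𝒪[F] = ((E.exists_isMinimal 𝒪[F]).choose * C⁻¹) • (C • E) := by
    rw [← mul_smul, inv_mul_cancel_right]; rfl
  exact hns ((hasSplitMultiplicativeReduction_iff_of_isMinimal_of_eq_smul 𝒪[F] hrel
    (C • E).isUnit_Δ.ne_zero).mpr hsplit)

end NonSplit


/-! ## §2 The inertia group fixes `√γ`: the twist is unramified -/

section Inertia

variable {F : Type} [Field F] [ValuativeRel F] [TopologicalSpace F] [IsNonarchimedeanLocalField F]

/-- The ring identity `-c₄c₆ = a₁^{10} + 4·T(a₁,…,a₆)`. [folklore] -/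
private theorem neg_c₄_mul_c₆_eq' {S : Type*} [CommRing S] (W : WeierstrassCurve S) :
    -(W.c₄ * W.c₆) = W.a₁ ^ 10 + 4 * (5 * W.a₁ ^ 8 * W.a₂ - 15 * W.a₁ ^ 7 * W.a₃
      + 40 * W.a₁ ^ 6 * W.a₂ ^ 2 - 30 * W.a₁ ^ 6 * W.a₄ - 180 * W.a₁ ^ 5 * W.a₂ * W.a₃
      + 160 * W.a₁ ^ 4 * W.a₂ ^ 3 - 360 * W.a₁ ^ 4 * W.a₂ * W.a₄ + 270 * W.a₁ ^ 4 * W.a₃ ^ 2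
      + 216 * W.a₁ ^ 4 * W.a₆ - 720 * W.a₁ ^ 3 * W.a₂ ^ 2 * W.a₃ + 864 * W.a₁ ^ 3 * W.a₃ * W.a₄
      + 320 * W.a₁ ^ 2 * W.a₂ ^ 4 - 1440 * W.a₁ ^ 2 * W.a₂ ^ 2 * W.a₄
      + 1296 * W.a₁ ^ 2 * W.a₂ * W.a₃ ^ 2 + 1728 * W.a₁ ^ 2 * W.a₂ * W.a₆ + 864 * W.a₁ ^ 2 * W.a₄ ^ 2
      - 960 * W.a₁ * W.a₂ ^ 3 * W.a₃ + 3456 * W.a₁ * W.a₂ * W.a₃ * W.a₄ - 1296 * W.a₁ * W.a₃ ^ 3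
      - 5184 * W.a₁ * W.a₃ * W.a₆ + 256 * W.a₂ ^ 5 - 1920 * W.a₂ ^ 3 * W.a₄ + 864 * W.a₂ ^ 2 * W.a₃ ^ 2
      + 3456 * W.a₂ ^ 2 * W.a₆ + 3456 * W.a₂ * W.a₄ ^ 2 - 2592 * W.a₃ ^ 2 * W.a₄
      - 10368 * W.a₄ * W.a₆) := by
  simp only [WeierstrassCurve.c₄, WeierstrassCurve.c₆, WeierstrassCurve.b₂, WeierstrassCurve.b₄,
    WeierstrassCurve.b₆]
  ring

/-- The ring identity `c₄ = a₁^4 + 2·T'(a₁,…,a₄)`. [folklore] -/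
private theorem c₄_eq_a₁_pow_four_add_two_mul' {S : Type*} [CommRing S] (W : WeierstrassCurve S) :
    W.c₄ = W.a₁ ^ 4 + 2 * (4 * W.a₁ ^ 2 * W.a₂ + 8 * W.a₂ ^ 2 - 24 * W.a₄ - 12 * W.a₁ * W.a₃) := by
  simp only [WeierstrassCurve.c₄, WeierstrassCurve.b₂, WeierstrassCurve.b₄]
  ring

/-- An element of `F̄` fixed by the inertia group lies in `F_nr` (`I_F = Gal(F̄/F_nr)` and the
Galois correspondence for `F̄/F`). [folklore] -/
private theorem mem_maxUnramified_of_forall_absInertia [CharZero F] {x : AlgebraicClosure F}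
    (hx : ∀ σ ∈ absInertia F, σ • x = x) : x ∈ maxUnramified F := by
  haveI : IsGalois F (AlgebraicClosure F) := {}
  rw [← InfiniteGalois.fixedField_fixingSubgroup (maxUnramified F)]
  intro τ
  have hτ : (absoluteGaloisGroup.toAlgEquiv F).symm
      (τ : AlgebraicClosure F ≃ₐ[F] AlgebraicClosure F) ∈ absInertia F := by
    rw [mem_absInertia_iff_forall_mem_maxUnramified]
    intro y hy
    rw [absoluteGaloisGroup.smul_def, MulEquiv.apply_symm_apply]
    exact (IntermediateField.mem_fixingSubgroup_iff _ _).1 τ.2 y hy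
  have := hx _ hτ
  rw [absoluteGaloisGroup.smul_def, MulEquiv.apply_symm_apply] at this
  exact this

omit [ValuativeRel F] [TopologicalSpace F] [IsNonarchimedeanLocalField F] in
/-- `σ t = ± t` if `σ` fixes `t²`. [folklore] -/
private theorem smul_eq_or_eq_neg_of_sq {σ : absoluteGaloisGroup F} {t a : AlgebraicClosure F}
    (ht : t ^ 2 = a) (ha : σ • a = a) : σ • t = t ∨ σ • t = -t := by
  have h : (σ • t) ^ 2 = t ^ 2 := by rw [← smul_pow', ht, ha]
  have h' : (σ • t - t) * (σ • t + t) = 0 := by linear_combination h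
  rcases mul_eq_zero.mp h' with h1 | h1
  · exact Or.inl (sub_eq_zero.mp h1)
  · exact Or.inr (eq_neg_of_add_eq_zero_left h1)

/-- **Residue characteristic `2`**: an inertia element with `σ s = ± s` fixes `s` when
`s² = 1 + 4δ`, `|δ| ≤ 1`, `|2| < 1`: `y = (1 + s)/2` satisfies `y² - y = δ`, so `|y| ≤ 1`, and
`σ s = -s` would give `|σ y - y| = |s| = 1`, contradicting `σ ∈ I_F`. [folklore] -/
private theorem smul_eq_of_mem_absInertia_of_sq_eq_one_add_four_mul [CharZero F]
    {σ : absoluteGaloisGroup F} (hσ : σ ∈ absInertia F)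
    (h2 : algNorm F (2 : AlgebraicClosure F) < 1)
    {s δ : AlgebraicClosure F} (hδ : algNorm F δ ≤ 1) (hs : s ^ 2 = 1 + 4 * δ)
    (hσs : σ • s = s ∨ σ • s = -s) : σ • s = s := by
  have h4δ : algNorm F (4 * δ) < 1 := by
    rw [show (4 : AlgebraicClosure F) = 2 * 2 by norm_num, algNorm_mul, algNorm_mul]
    have h2' := algNorm_nonneg (F := F) (2 : AlgebraicClosure F)
    calc algNorm F 2 * algNorm F 2 * algNorm F δ ≤ algNorm F 2 * algNorm F 2 * 1 := by
          gcongr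
      _ < 1 := by rw [mul_one]; exact mul_lt_one_of_nonneg_of_lt_one_left h2' h2 h2.le
  -- `‖s‖ = 1`
  have hns : algNorm F s = 1 := by
    have h1 : algNorm F (s ^ 2) = 1 := by
      rw [hs, algNorm_add_eq_left (by rwa [algNorm_one]), algNorm_one]
    rw [algNorm_pow] at h1
    exact (pow_eq_one_iff_of_nonneg (algNorm_nonneg s) two_ne_zero).mp h1
  -- `y = (1 + s)/2`, `y² = y + δ`, `‖y‖ ≤ 1`
  set y : AlgebraicClosure F := (1 + s) / 2 with hy
  have hyeq : y ^ 2 = y + δ := by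
    have e : δ = (s ^ 2 - 1) / 4 := by rw [hs]; ring
    rw [e, hy]; field_simp; ring
  have hny : algNorm F y ≤ 1 := by
    by_contra hgt
    rw [not_le] at hgt
    have h1 : algNorm F (y ^ 2) ≤ algNorm F y := by
      rw [hyeq]
      exact (algNorm_add_le y δ).trans (max_le le_rfl (hδ.trans hgt.le))
    rw [algNorm_pow, pow_two] at h1
    have hpos : 0 < algNorm F y := lt_trans zero_lt_one hgt
    have : algNorm F y * algNorm F y ≤ algNorm F y * 1 := by rw [mul_one]; exact h1
    exact absurd (le_of_mul_le_mul_left this hpos) (not_le.mpr hgt)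
  rcases hσs with h | h
  · exact h
  · exfalso
    have hlt := (mem_absInertia_iff_algNorm.mp hσ) y hny
    have hσy : σ • y = (1 - s) / 2 := by
      rw [hy, absoluteGaloisGroup.smul_def, map_div₀, map_add, map_one, map_ofNat,
        ← absoluteGaloisGroup.smul_def, h, ← sub_eq_add_neg]
    rw [hσy, hy, show (1 - s) / 2 - (1 + s) / 2 = -s by ring, algNorm_neg, hns] at hlt
    exact lt_irrefl _ hlt

variable [CharZero F]

/-- **The inertia group fixes `√γ(E/F)` when the minimal model has multiplicative reduction**,
i.e. `F(√γ) ⊆ F_nr`: "`E` is a twisted Tate curve, twisted by the unramified quadratic extension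
`L`" (Kramer p. 123; Silverman ATAEC V.5.3 with Ex. 5.11 (a): the character of `E/E_q` is
unramified). On an integral minimal model `I` (`c₄, c₆` units) `t = z·u·c₆` has
`t² = -c₄(I)c₆(I)`, a unit; for `|2| = 1`, `σ t = -t` gives `|σt - t| = |2t| = 1`; for `|2| < 1`,
`a₁` is a unit and `s = t/a₁⁵` has `s² = 1 + 4δ`.
[cite: SilvermanATAEC1994, Thm. V.5.3 and Ex. 5.11 (PDF pp. 407–409)] -/
theorem sqrt_gamma_mem_maxUnramified (E : WeierstrassCurve F) [E.IsElliptic]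
    (hmult : (E.minimal 𝒪[F]).HasMultiplicativeReduction 𝒪[F]) {z : AlgebraicClosure F}
    (hz : z ^ 2 = algebraMap F (AlgebraicClosure F) (-(E.c₄ / E.c₆))) :
    z ∈ maxUnramified F := by
  -- the minimal model `W = C₀ • E` and its integral model `I`
  set C₀ := (E.exists_isMinimal 𝒪[F]).choose with hC₀
  set W := E.minimal 𝒪[F] with hW
  have hWE : W = C₀ • E := rfl
  haveI : W.IsMinimal 𝒪[F] := hmult.toIsMinimal
  set I := W.integralModel 𝒪[F] with hI
  set ι := algebraMap 𝒪[F] (AlgebraicClosure F) with hι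
  -- `c₄(I)` is a unit, `Δ(I) ∈ 𝔪`, hence `c₆(I)` is a unit
  have hc4 : I.c₄ ∉ 𝓂[F] := by
    have h := hmult.multiplicativeReduction
    rw [← integralModel_c₄_eq 𝒪[F] W,
      IsDedekindDomain.HeightOneSpectrum.valuation_eq_one_iff_notMem] at h
    exact h
  have hΔ : I.Δ ∈ 𝓂[F] := by
    have h := hmult.badReduction
    rw [← integralModel_Δ_eq 𝒪[F] W, IsDedekindDomain.HeightOneSpectrum.valuation_lt_one_iff_mem] at h
    exact h
  have hc6 : I.c₆ ∉ 𝓂[F] := by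
    intro h6
    apply hc4
    have hrel : I.c₄ ^ 3 = 1728 * I.Δ + I.c₆ ^ 2 := by
      have := I.c_relation; linear_combination -this
    have hmem : I.c₄ ^ 3 ∈ 𝓂[F] :=
      hrel ▸ Ideal.add_mem _ (Ideal.mul_mem_left _ _ hΔ) (Ideal.pow_mem_of_mem _ h6 2 (by norm_num))
    exact Ideal.IsPrime.mem_of_pow_mem inferInstance 3 hmem
  have hnc4 : algNorm F (ι I.c₄) = 1 :=
    le_antisymm (algNorm_algebraMap_integer _)
      (not_lt.mp fun h => hc4 (algNorm_algebraMap_lt_one_iff_mem_maximalIdeal.mp h))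
  have hnc6 : algNorm F (ι I.c₆) = 1 :=
    le_antisymm (algNorm_algebraMap_integer _)
      (not_lt.mp fun h => hc6 (algNorm_algebraMap_lt_one_iff_mem_maximalIdeal.mp h))
  have hc60 : ι I.c₆ ≠ 0 := fun h => by rw [h, algNorm_zero] at hnc6; exact zero_ne_one hnc6
  -- `t = z · u · c₆(W)` has `t² = -c₄(I) c₆(I)`
  have hWc₄ : W.c₄ = algebraMap 𝒪[F] F I.c₄ := (integralModel_c₄_eq 𝒪[F] W).symm
  have hWc₆ : W.c₆ = algebraMap 𝒪[F] F I.c₆ := (integralModel_c₆_eq 𝒪[F] W).symm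
  have hEc₄ : E.c₄ = (C₀.u : F) ^ 4 * W.c₄ := by
    rw [hWE, variableChange_c₄, ← mul_assoc, ← mul_pow, Units.mul_inv, one_pow, one_mul]
  have hEc₆ : E.c₆ = (C₀.u : F) ^ 6 * W.c₆ := by
    rw [hWE, variableChange_c₆, ← mul_assoc, ← mul_pow, Units.mul_inv, one_pow, one_mul]
  set t : AlgebraicClosure F :=
    z * algebraMap F (AlgebraicClosure F) ((C₀.u : F) * W.c₆) with ht
  have hιF : ∀ a : 𝒪[F], ι a = algebraMap F (AlgebraicClosure F) (algebraMap 𝒪[F] F a) :=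
    fun a => IsScalarTower.algebraMap_apply 𝒪[F] F (AlgebraicClosure F) a
  have hu0 : algebraMap F (AlgebraicClosure F) (C₀.u : F) ≠ 0 :=
    (_root_.map_ne_zero _).mpr C₀.u.ne_zero
  have hc60' : algebraMap F (AlgebraicClosure F) W.c₆ ≠ 0 := by rwa [hWc₆, ← hιF]
  have ht2 : t ^ 2 = -(ι I.c₄ * ι I.c₆) := by
    rw [ht, mul_pow, hz, hEc₄, hEc₆, hιF, hιF, ← hWc₄, ← hWc₆]
    simp only [map_neg, map_div₀, map_mul, map_pow]
    field_simp
  -- it suffices that inertia fixes `t`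
  suffices hfix : ∀ σ ∈ absInertia F, σ • t = t by
    have htmem : t ∈ maxUnramified F := mem_maxUnramified_of_forall_absInertia hfix
    have hzt : z = t / algebraMap F (AlgebraicClosure F) ((C₀.u : F) * W.c₆) := by
      rw [ht, mul_div_assoc, div_self (by rw [map_mul]; exact mul_ne_zero hu0 hc60'), mul_one]
    rw [hzt]
    exact div_mem htmem ((maxUnramified F).algebraMap_mem _)
  intro σ hσ
  have hν : σ • (-(ι I.c₄ * ι I.c₆)) = -(ι I.c₄ * ι I.c₆) := by
    rw [hιF, hιF, ← map_mul, ← map_neg, absoluteGaloisGroup.smul_def, AlgEquiv.commutes]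
  have hσt := smul_eq_or_eq_neg_of_sq ht2 hν
  have hnt : algNorm F t = 1 := by
    have h1 : algNorm F (t ^ 2) = 1 := by rw [ht2, algNorm_neg, algNorm_mul, hnc4, hnc6, mul_one]
    rw [algNorm_pow] at h1
    exact (pow_eq_one_iff_of_nonneg (algNorm_nonneg t) two_ne_zero).mp h1
  by_cases h2 : algNorm F (2 : AlgebraicClosure F) < 1
  · -- residue characteristic `2`: `a₁` is a unit, `s = t / a₁⁵`, `s² = 1 + 4δ`
    have hna1 : algNorm F (ι I.a₁) = 1 := by
      refine le_antisymm (algNorm_algebraMap_integer _) (not_lt.mp fun hlt => ?_)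
      have e : ι I.c₄ = (ι I.a₁) ^ 4 + 2 * ι (4 * I.a₁ ^ 2 * I.a₂ + 8 * I.a₂ ^ 2 - 24 * I.a₄
          - 12 * I.a₁ * I.a₃) := by
        rw [c₄_eq_a₁_pow_four_add_two_mul' I]; simp only [map_add, map_mul, map_pow, map_ofNat]
      have hlt' : algNorm F (ι I.c₄) < 1 := by
        rw [e]
        refine lt_of_le_of_lt (algNorm_add_le _ _) (max_lt ?_ ?_)
        · rw [algNorm_pow]; exact pow_lt_one₀ (algNorm_nonneg _) hlt (by norm_num)
        · rw [algNorm_mul]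
          exact mul_lt_one_of_nonneg_of_lt_one_left (algNorm_nonneg _) h2
            (algNorm_algebraMap_integer _)
      rw [hnc4] at hlt'
      exact lt_irrefl _ hlt'
    have ha10 : ι I.a₁ ≠ 0 := fun h => by rw [h, algNorm_zero] at hna1; exact zero_ne_one hna1
    set T := ι (5 * I.a₁ ^ 8 * I.a₂ - 15 * I.a₁ ^ 7 * I.a₃
      + 40 * I.a₁ ^ 6 * I.a₂ ^ 2 - 30 * I.a₁ ^ 6 * I.a₄ - 180 * I.a₁ ^ 5 * I.a₂ * I.a₃
      + 160 * I.a₁ ^ 4 * I.a₂ ^ 3 - 360 * I.a₁ ^ 4 * I.a₂ * I.a₄ + 270 * I.a₁ ^ 4 * I.a₃ ^ 2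
      + 216 * I.a₁ ^ 4 * I.a₆ - 720 * I.a₁ ^ 3 * I.a₂ ^ 2 * I.a₃ + 864 * I.a₁ ^ 3 * I.a₃ * I.a₄
      + 320 * I.a₁ ^ 2 * I.a₂ ^ 4 - 1440 * I.a₁ ^ 2 * I.a₂ ^ 2 * I.a₄
      + 1296 * I.a₁ ^ 2 * I.a₂ * I.a₃ ^ 2 + 1728 * I.a₁ ^ 2 * I.a₂ * I.a₆ + 864 * I.a₁ ^ 2 * I.a₄ ^ 2
      - 960 * I.a₁ * I.a₂ ^ 3 * I.a₃ + 3456 * I.a₁ * I.a₂ * I.a₃ * I.a₄ - 1296 * I.a₁ * I.a₃ ^ 3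
      - 5184 * I.a₁ * I.a₃ * I.a₆ + 256 * I.a₂ ^ 5 - 1920 * I.a₂ ^ 3 * I.a₄ + 864 * I.a₂ ^ 2 * I.a₃ ^ 2
      + 3456 * I.a₂ ^ 2 * I.a₆ + 3456 * I.a₂ * I.a₄ ^ 2 - 2592 * I.a₃ ^ 2 * I.a₄
      - 10368 * I.a₄ * I.a₆) with hT
    have hν' : -(ι I.c₄ * ι I.c₆) = (ι I.a₁) ^ 10 + 4 * T := by
      rw [← map_mul, ← map_neg, neg_c₄_mul_c₆_eq' I]; simp only [map_add, map_mul, map_pow, map_ofNat, hT]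
    set s : AlgebraicClosure F := t / (ι I.a₁) ^ 5 with hsdef
    set δ : AlgebraicClosure F := T / (ι I.a₁) ^ 10 with hδdef
    have hδ : algNorm F δ ≤ 1 := by
      rw [hδdef, algNorm_div, algNorm_pow, hna1, one_pow, div_one]
      exact algNorm_algebraMap_integer _
    have hs2 : s ^ 2 = 1 + 4 * δ := by
      rw [hsdef, hδdef, div_pow, ht2, hν']
      field_simp
    have hσa : σ • ((ι I.a₁) ^ 5) = (ι I.a₁) ^ 5 := by
      rw [hιF, ← map_pow, absoluteGaloisGroup.smul_def, AlgEquiv.commutes]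
    have hsd : σ • s = σ • t / σ • ((ι I.a₁) ^ 5) := by
      rw [hsdef, absoluteGaloisGroup.smul_def, absoluteGaloisGroup.smul_def,
        absoluteGaloisGroup.smul_def, map_div₀]
    have hσs : σ • s = s ∨ σ • s = -s := by
      rcases hσt with h | h
      · left; rw [hsd, h, hσa]
      · right; rw [hsd, h, hσa, neg_div]
    have hfix := smul_eq_of_mem_absInertia_of_sq_eq_one_add_four_mul hσ h2 hδ hs2 hσs
    have hts : t = s * (ι I.a₁) ^ 5 := by rw [hsdef, div_mul_cancel₀ _ (pow_ne_zero 5 ha10)]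
    rw [hts, smul_mul', hfix, hσa]
  · -- odd residue characteristic: `σ t = -t` would give `‖σt - t‖ = ‖2t‖ = 1`
    rw [not_lt] at h2
    have h2' : algNorm F (2 : AlgebraicClosure F) = 1 := by
      refine le_antisymm ?_ h2
      have := algNorm_algebraMap_integer (F := F) (2 : 𝒪[F])
      rwa [map_ofNat] at this
    rcases hσt with h | h
    · exact h
    · exfalso
      have hlt := (mem_absInertia_iff_algNorm.mp hσ) t hnt.le
      rw [h, show -t - t = -(2 * t) by ring, algNorm_neg, algNorm_mul, h2', hnt, mul_one] at hlt
      exact lt_irrefl _ hlt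

end Inertia


/-! ## §3 The unramified quadratic extension: square roots and norm group -/

section Weil

open LocalWeilDatum AbstractCFT

variable {F : Type} [Field F] [ValuativeRel F] [TopologicalSpace F] [IsNonarchimedeanLocalField F]

/-- Weil-group elements of degree `0` lie in the inertia group. [folklore] -/
private theorem toAbsGalois_mem_absInertia_of_degZ_eq_zero {w : WeilGroup F}
    (h : degZ (degHom F) w = 0) : WeilGroup.toAbsGalois F w ∈ absInertia F := by
  rw [← WeilGroup.mem_inertia_iff,
    ← WeilGroup.deg_eq_zero_iff_mem_inertia IsFrobPow.mul_holds IsFrobPow.unique_holds,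
    ← degZ_degHom F w]
  exact h

/-- **Weil-group elements of even degree fix the square roots in `F_nr` of elements of `F`**
(`w = i·φ^{2k}` with `i` inert, `φ` a Frobenius; `φ z = ± z` so `φ² z = z`; `i` fixes `F_nr`).
[cite: SerreLocalFields1979, Ch. IV §4 Cor. 2 to Prop. 16] -/
theorem toAbsGalois_smul_eq_of_two_dvd_degZ {z : AlgebraicClosure F} (hz : z ∈ maxUnramified F)
    {a : F} (hza : z ^ 2 = algebraMap F (AlgebraicClosure F) a) {w : WeilGroup F}
    (hw : (2 : ℤ) ∣ degZ (degHom F) w) : WeilGroup.toAbsGalois F w • z = z := by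
  obtain ⟨φ, hφ⟩ := exists_degZ_eq_one F
  obtain ⟨k, hk⟩ := hw
  have hφa : WeilGroup.toAbsGalois F φ • algebraMap F (AlgebraicClosure F) a =
      algebraMap F (AlgebraicClosure F) a := by
    rw [absoluteGaloisGroup.smul_def, AlgEquiv.commutes]
  have h2 : WeilGroup.toAbsGalois F (φ ^ 2) • z = z := by
    rw [map_pow, pow_two, mul_smul]
    rcases smul_eq_or_eq_neg_of_sq hza hφa with h | h
    · rw [h, h]
    · rw [h, smul_neg, h, neg_neg]
  have h2k : WeilGroup.toAbsGalois F ((φ ^ 2) ^ k) • z = z := by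
    rw [map_zpow]
    exact MulAction.mem_stabilizer_iff.mp
      (Subgroup.zpow_mem _ (MulAction.mem_stabilizer_iff.mpr h2) k)
  have hφ' : Multiplicative.toAdd (degHom F φ) = 1 := hφ
  have hk' : Multiplicative.toAdd (degHom F w) = 2 * k := hk
  have hi : degZ (degHom F) (w * ((φ ^ 2) ^ k)⁻¹) = 0 := by
    simp only [degZ, map_mul, map_inv, map_zpow, map_pow, toAdd_mul, toAdd_inv, toAdd_zpow,
      toAdd_pow, smul_eq_mul, hφ', hk']
    ring
  have hiI := toAbsGalois_mem_absInertia_of_degZ_eq_zero hi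
  calc WeilGroup.toAbsGalois F w • z
      = WeilGroup.toAbsGalois F (w * ((φ ^ 2) ^ k)⁻¹ * (φ ^ 2) ^ k) • z := by
        rw [inv_mul_cancel_right]
    _ = WeilGroup.toAbsGalois F (w * ((φ ^ 2) ^ k)⁻¹) •
          (WeilGroup.toAbsGalois F ((φ ^ 2) ^ k) • z) := by rw [map_mul, mul_smul]
    _ = z := by rw [h2k, (mem_absInertia_iff_forall_mem_maxUnramified.mp hiI) z hz]

omit [ValuativeRel F] [TopologicalSpace F] [IsNonarchimedeanLocalField F] in
/-- In characteristic `0` every subextension of `F̄` is separable. [folklore] -/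
private theorem le_sepClosure' [CharZero F] (K : IntermediateField F (AlgebraicClosure F)) :
    K ≤ sepClosure F :=
  fun y _ => mem_separableClosure_iff.2 (Algebra.IsSeparable.isSeparable F y)

/-- **The Weil subgroup of an unramified quadratic `K' = F(x)`, `x² = d`, consists of elements of
even degree**: an odd-degree element fixing `x` would make the Frobenius, hence all of `W_F`, fix
`x`, forcing `x ∈ F` (Tate (1.4.1): `K ↦ W_F ∩ G_K` is injective), i.e. `d ∈ F²`.
[cite: TateCorvallis1979, (1.4.1)] -/
theorem two_dvd_degZ_of_mem_fieldSubgroup [CharZero F]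
    {K' : IntermediateField F (AlgebraicClosure F)} (hK : K' ≤ maxUnramified F) {d : F}
    (hd : ¬ IsSquare d) {x : K'} (hx : x ^ 2 = algebraMap F K' d) {w : WeilGroup F}
    (hw : w ∈ fieldSubgroup F K') : (2 : ℤ) ∣ degZ (degHom F) w := by
  by_contra hodd
  obtain ⟨φ, hφ⟩ := exists_degZ_eq_one F
  set xF : AlgebraicClosure F := (x : AlgebraicClosure F) with hxF
  have hxF2 : xF ^ 2 = algebraMap F (AlgebraicClosure F) d := by
    have := congrArg (fun y : K' => (y : AlgebraicClosure F)) hx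
    simpa using this
  have hxmem : xF ∈ maxUnramified F := hK x.2
  have hwx : WeilGroup.toAbsGalois F w • xF = xF := (mem_fieldSubgroup_iff F).mp hw xF x.2
  obtain ⟨k, hk⟩ : ∃ k, degZ (degHom F) w = 2 * k + 1 := ⟨degZ (degHom F) w / 2, by omega⟩
  have heven : (2 : ℤ) ∣ degZ (degHom F) (w * φ⁻¹) := by
    have hφ' : Multiplicative.toAdd (degHom F φ) = 1 := hφ
    have hk' : Multiplicative.toAdd (degHom F w) = 2 * k + 1 := hk
    refine ⟨k, ?_⟩
    simp only [degZ, map_mul, map_inv, toAdd_mul, toAdd_inv, hφ', hk']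
    ring
  -- `φ` fixes `x`
  have hφx : WeilGroup.toAbsGalois F φ • xF = xF := by
    have h1 := toAbsGalois_smul_eq_of_two_dvd_degZ hxmem hxF2 heven
    rw [map_mul, mul_smul] at h1
    have h2 : WeilGroup.toAbsGalois F φ⁻¹ • xF = xF := by
      have := congrArg (fun y => (WeilGroup.toAbsGalois F w)⁻¹ • y) h1
      simp only [inv_smul_smul] at this
      rw [this]
      exact inv_smul_eq_iff.mpr hwx.symm
    rw [map_inv, inv_smul_eq_iff] at h2
    exact h2.symm
  -- hence every Weil element fixes `x`
  have hall : ∀ w' : WeilGroup F, WeilGroup.toAbsGalois F w' • xF = xF := by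
    intro w'
    have hn : WeilGroup.toAbsGalois F (φ ^ degZ (degHom F) w') • xF = xF := by
      rw [map_zpow]
      exact MulAction.mem_stabilizer_iff.mp
        (Subgroup.zpow_mem _ (MulAction.mem_stabilizer_iff.mpr hφx) _)
    have hi : degZ (degHom F) (w' * (φ ^ degZ (degHom F) w')⁻¹) = 0 := by
      have hφ' : Multiplicative.toAdd (degHom F φ) = 1 := hφ
      simp only [degZ, map_mul, map_inv, map_zpow, toAdd_mul, toAdd_inv, toAdd_zpow, smul_eq_mul,
        hφ']
      ring
    calc WeilGroup.toAbsGalois F w' • xF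
        = WeilGroup.toAbsGalois F (w' * (φ ^ degZ (degHom F) w')⁻¹ * φ ^ degZ (degHom F) w') •
            xF := by rw [inv_mul_cancel_right]
      _ = xF := by
          rw [map_mul, mul_smul, hn, (mem_absInertia_iff_forall_mem_maxUnramified.mp
            (toAbsGalois_mem_absInertia_of_degZ_eq_zero hi)) xF hxmem]
  -- so `x ∈ F`
  have hle : IntermediateField.adjoin F {xF} ≤ (⊥ : IntermediateField F (AlgebraicClosure F)) :=
    le_of_fieldSubgroup_le F (le_sepClosure' _) (le_sepClosure' _) fun w' _ =>
      (mem_fieldSubgroup_iff F).mpr fun y hy =>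
        smul_eq_self_of_mem_adjoin F (S := {xF})
          (fun s hs => by rw [Set.mem_singleton_iff.mp hs]; exact hall w') hy
  have hxbot : xF ∈ (⊥ : IntermediateField F (AlgebraicClosure F)) :=
    hle (IntermediateField.mem_adjoin_simple_self F xF)
  rw [IntermediateField.mem_bot] at hxbot
  obtain ⟨a, ha⟩ := hxbot
  apply hd
  refine ⟨a, (algebraMap F (AlgebraicClosure F)).injective ?_⟩
  rw [map_mul, ha, ← pow_two, hxF2]

/-- **An unramified quadratic `K'` contains every square root in `F_nr` of an element of `F`**
(Tate (1.4.1): `W_F ∩ G_{K'} ≤ W_F ∩ G_{F(z)}` forces `F(z) ⊆ K'`).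
[cite: TateCorvallis1979, (1.4.1)] -/
theorem mem_of_sq_eq_of_mem_maxUnramified [CharZero F]
    {K' : IntermediateField F (AlgebraicClosure F)} (hK : K' ≤ maxUnramified F)
    [FiniteDimensional F K'] {d : F} (hd : ¬ IsSquare d) {x : K'}
    (hx : x ^ 2 = algebraMap F K' d) {z : AlgebraicClosure F} (hz : z ∈ maxUnramified F) {a : F}
    (hza : z ^ 2 = algebraMap F (AlgebraicClosure F) a) : z ∈ K' := by
  have hle : IntermediateField.adjoin F {z} ≤ K' :=
    le_of_fieldSubgroup_le F (le_sepClosure' _) (le_sepClosure' _) fun w hw =>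
      (mem_fieldSubgroup_iff F).mpr fun y hy =>
        smul_eq_self_of_mem_adjoin F (S := {z})
          (fun s hs => by
            rw [Set.mem_singleton_iff.mp hs]
            exact toAbsGalois_smul_eq_of_two_dvd_degZ hz hza
              (two_dvd_degZ_of_mem_fieldSubgroup hK hd hx hw)) hy
  exact hle (IntermediateField.mem_adjoin_simple_self F z)

end Weil

section NormGroup

open LocalWeilDatum

variable {F : Type} [Field F] [ValuativeRel F] [TopologicalSpace F] [IsNonarchimedeanLocalField F]

/-- `ord (t⁻¹) = - ord t`. [folklore] -/
private theorem ord_inv' {t : F} (ht : t ≠ 0) : ord F t⁻¹ = -ord F t := by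
  have h := ord_mul F (inv_ne_zero ht) ht
  rw [inv_mul_cancel₀ ht, ord_one] at h
  omega

/-- `ord (t ^ k) = k · ord t` for `k ∈ ℤ`. [folklore] -/
private theorem ord_zpow' {t : F} (ht : t ≠ 0) (k : ℤ) : ord F (t ^ k) = k * ord F t := by
  cases k with
  | ofNat n => rw [Int.ofNat_eq_natCast, zpow_natCast, ord_pow F ht]
  | negSucc n =>
      rw [zpow_negSucc, ord_inv' (pow_ne_zero _ ht), ord_pow F ht, Int.negSucc_eq]
      push_cast
      ring

/-- `‖x⁻¹‖ = ‖x‖⁻¹` on `F̄`. [folklore] -/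
private theorem algNorm_inv' {x : AlgebraicClosure F} (hx : x ≠ 0) :
    algNorm F x⁻¹ = (algNorm F x)⁻¹ := by
  have h : algNorm F x⁻¹ * algNorm F x = 1 := by rw [← algNorm_mul, inv_mul_cancel₀ hx, algNorm_one]
  exact eq_inv_of_mul_eq_one_left h

/-- `‖x ^ k‖ = ‖x‖ ^ k` on `F̄`, `k ∈ ℤ`. [folklore] -/
private theorem algNorm_zpow' {x : AlgebraicClosure F} (hx : x ≠ 0) (k : ℤ) :
    algNorm F (x ^ k) = algNorm F x ^ k := by
  cases k with
  | ofNat n => rw [Int.ofNat_eq_natCast, zpow_natCast, zpow_natCast, algNorm_pow]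
  | negSucc n => rw [zpow_negSucc, zpow_negSucc, algNorm_inv' (pow_ne_zero _ hx), algNorm_pow]

/-- `‖t‖ = ‖ϖ‖^k ⟹ ord t = k`. [folklore] -/
private theorem ord_eq_of_algNorm_eq_zpow {ϖ : 𝒪[F]} (hϖ : Irreducible ϖ) {t : F} (ht : t ≠ 0)
    {k : ℤ} (h : algNorm F (algebraMap F (AlgebraicClosure F) t) =
      algNorm F (algebraMap 𝒪[F] (AlgebraicClosure F) ϖ) ^ k) : ord F t = k := by
  have hϖ0 : (ϖ : F) ≠ 0 := fun h0 => hϖ.ne_zero (Subtype.ext h0)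
  have hιϖ : algebraMap 𝒪[F] (AlgebraicClosure F) ϖ = algebraMap F (AlgebraicClosure F) (ϖ : F) :=
    IsScalarTower.algebraMap_apply 𝒪[F] F (AlgebraicClosure F) ϖ
  have hϖ0' : algebraMap F (AlgebraicClosure F) (ϖ : F) ≠ 0 := (_root_.map_ne_zero _).mpr hϖ0
  have hnϖ : algNorm F (algebraMap F (AlgebraicClosure F) (ϖ : F)) ≠ 0 := fun h0 =>
    hϖ0' (algNorm_eq_zero_iff.mp h0)
  set u : F := t * ((ϖ : F) ^ k)⁻¹ with hu
  have hu0 : u ≠ 0 := mul_ne_zero ht (inv_ne_zero (zpow_ne_zero k hϖ0))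
  have htu : t = u * (ϖ : F) ^ k := by rw [hu, inv_mul_cancel_right₀ (zpow_ne_zero k hϖ0)]
  have hnu : algNorm F (algebraMap F (AlgebraicClosure F) u) = 1 := by
    rw [hιϖ] at h
    rw [htu, map_mul, map_zpow₀, algNorm_mul, algNorm_zpow' hϖ0'] at h
    exact mul_right_cancel₀ (zpow_ne_zero k hnϖ) (h.trans (one_mul _).symm)
  have hvu : valuation F u = 1 := by
    refine le_antisymm ?_ (not_lt.mp fun hlt => ?_)
    · exact (Valuation.mem_integer_iff _ _).mp (algNorm_algebraMap_le_one_iff.mp hnu.le)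
    · have := algNorm_algebraMap_lt_one_iff.mpr hlt
      rw [hnu] at this
      exact lt_irrefl _ this
  have hou : ord F u = 0 := (ord_eq_zero_iff F hu0).mpr hvu
  rw [htu, ord_mul F hu0 (zpow_ne_zero k hϖ0), hou, ord_zpow' hϖ0, ord_eq_one_of_irreducible F hϖ]
  ring

variable [CharZero F] {K' : IntermediateField F (AlgebraicClosure F)}

/-- `|σ w| = |w|` for `w ∈ K'`, `σ ∈ Aut(K'/F)` (lift `σ` to `F̄`; `Γ_F` acts by isometries). [folklore] -/
private theorem algNorm_coe_algEquiv (σ : K' ≃ₐ[F] K') (w : K') :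
    algNorm F ((σ w : K') : AlgebraicClosure F) = algNorm F (w : AlgebraicClosure F) := by
  have e : ((σ w : K') : AlgebraicClosure F) =
      σ.liftNormal (AlgebraicClosure F) (w : AlgebraicClosure F) :=
    (AlgEquiv.liftNormal_commutes σ (AlgebraicClosure F) w).symm
  have h := algNorm_smul ((absoluteGaloisGroup.toAlgEquiv F).symm (σ.liftNormal (AlgebraicClosure F)))
    (w : AlgebraicClosure F)
  rw [absoluteGaloisGroup.smul_def, MulEquiv.apply_symm_apply] at h
  rw [e, h]

/-- **Norms from the unramified quadratic `K' = F(x)` have even valuation**: for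
`t = s² - d y² = N(s + yx)` with `s + yx ∈ K' ⊆ F_nr`, `|s + yx| ∈ |ϖ|^ℤ` (Serre IV §4: `F_nr/F`
is unramified) and `|σ(s + yx)| = |s + yx|`, so `|t| = |ϖ|^{2n}`.
[cite: SerreLocalFields1979, Ch. V §2 Cor. to Prop. 3 (norm group of an unramified extension)] -/
theorem two_dvd_ord_of_mem_quadraticNormSubgroup (hK : K' ≤ maxUnramified F)
    (h2 : Module.finrank F K' = 2) {d : F} (hd : ¬ IsSquare d) {x : K'}
    (hx : x ^ 2 = algebraMap F K' d) {σ : K' ≃ₐ[F] K'} (hσ : σ ≠ 1) {t : Fˣ}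
    (ht : t ∈ quadraticNormSubgroup F d) : (2 : ℤ) ∣ ord F (t : F) := by
  obtain ⟨s, y, hst⟩ := ht
  obtain ⟨ϖ, hϖ⟩ := IsDiscreteValuationRing.exists_irreducible 𝒪[F]
  set w : K' := algebraMap F K' s + algebraMap F K' y * x with hw
  have hN : w * σ w = algebraMap F K' (t : F) := by rw [hw, add_mul_mul_algEquiv h2 hd hx hσ, hst]
  have hw0 : w ≠ 0 := by
    intro h0
    apply t.ne_zero
    apply (algebraMap F K').injective
    rw [← hN, h0, zero_mul, map_zero]
  have hwmem : (w : AlgebraicClosure F) ∈ maxUnramified F := hK w.2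
  have hw0' : (w : AlgebraicClosure F) ≠ 0 := by
    intro h0; apply hw0; exact_mod_cast h0
  obtain ⟨n, hn⟩ := exists_algNorm_eq_zpow_of_mem_maxUnramified hϖ hwmem hw0'
  have hϖ0' : algebraMap 𝒪[F] (AlgebraicClosure F) ϖ ≠ 0 := by
    rw [IsScalarTower.algebraMap_apply 𝒪[F] F (AlgebraicClosure F)]
    exact (_root_.map_ne_zero _).mpr fun h0 => hϖ.ne_zero (Subtype.ext h0)
  have hnϖ : algNorm F (algebraMap 𝒪[F] (AlgebraicClosure F) ϖ) ≠ 0 := fun h0 =>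
    hϖ0' (algNorm_eq_zero_iff.mp h0)
  have htot : algNorm F (algebraMap F (AlgebraicClosure F) (t : F)) =
      algNorm F (algebraMap 𝒪[F] (AlgebraicClosure F) ϖ) ^ (2 * n) := by
    have e : algebraMap F (AlgebraicClosure F) (t : F) =
        (w : AlgebraicClosure F) * ((σ w : K') : AlgebraicClosure F) := by
      have := congrArg (fun v : K' => (v : AlgebraicClosure F)) hN
      simp only [MulMemClass.coe_mul] at this
      rw [this]
      rfl
    rw [e, algNorm_mul, algNorm_coe_algEquiv, hn, ← zpow_add₀ hnϖ, two_mul]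
  exact ⟨n, ord_eq_of_algNorm_eq_zpow hϖ t.ne_zero htot⟩

/-- **The norm group of the unramified quadratic extension is the group of units of even
valuation** (Serre, *Local Fields*, Ch. V §2, Cor. to Prop. 3; here: `N K'^× ⊆ {2 ∣ ord}`, both of
index `2` in `F^×` — the former by local class field theory, tree
`index_normSubgroup_eq_finrank_holds` — hence equal).
[cite: SerreLocalFields1979, Ch. V §2 Cor. to Prop. 3] -/
theorem mem_quadraticNormSubgroup_iff_two_dvd_ord (hK : K' ≤ maxUnramified F)
    (h2 : Module.finrank F K' = 2) {d : F} (hd : ¬ IsSquare d) {x : K'}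
    (hx : x ^ 2 = algebraMap F K' d) {σ : K' ≃ₐ[F] K'} (hσ : σ ≠ 1) (t : Fˣ) :
    t ∈ quadraticNormSubgroup F d ↔ (2 : ℤ) ∣ ord F (t : F) := by
  refine ⟨two_dvd_ord_of_mem_quadraticNormSubgroup hK h2 hd hx hσ, fun ht => ?_⟩
  obtain ⟨ϖ, hϖ⟩ := IsDiscreteValuationRing.exists_irreducible 𝒪[F]
  have hϖ0 : (ϖ : F) ≠ 0 := fun h0 => hϖ.ne_zero (Subtype.ext h0)
  have hNm : (quadraticNormSubgroup F d).index = 2 :=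
    index_quadraticNormSubgroup_eq_two_of_index_normSubgroup_eq_finrank F
      (index_normSubgroup_eq_finrank_holds F) hd
  by_contra htN
  have hϖN : Units.mk0 (ϖ : F) hϖ0 ∉ quadraticNormSubgroup F d := fun h => by
    have h' := two_dvd_ord_of_mem_quadraticNormSubgroup hK h2 hd hx hσ h
    rw [Units.val_mk0, ord_eq_one_of_irreducible F hϖ] at h'
    omega
  have hprod : t * Units.mk0 (ϖ : F) hϖ0 ∈ quadraticNormSubgroup F d :=
    (Subgroup.mul_mem_iff_of_index_two hNm).mpr (iff_of_false htN hϖN)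
  have h' := two_dvd_ord_of_mem_quadraticNormSubgroup hK h2 hd hx hσ hprod
  rw [Units.val_mul, Units.val_mk0, ord_mul F t.ne_zero hϖ0, ord_eq_one_of_irreducible F hϖ] at h'
  omega

end NormGroup

section Gamma

variable {F : Type} [Field F] [ValuativeRel F] [TopologicalSpace F] [IsNonarchimedeanLocalField F]
  [CharZero F]

/-- **`γ(E/F)` becomes a square in every unramified quadratic extension** when the minimal model
has multiplicative reduction: `√γ ∈ F_nr` (the twist `F(√γ)/F` is unramified, Silverman ATAEC
V.5.3 with Ex. 5.11) and an unramified quadratic `K'` contains all such square roots.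
[cite: SilvermanATAEC1994, Thm. V.5.3 (PDF pp. 407–408)] -/
theorem isSquare_gamma_of_le_maxUnramified (E : WeierstrassCurve F) [E.IsElliptic]
    (hmult : (E.minimal 𝒪[F]).HasMultiplicativeReduction 𝒪[F])
    {K' : IntermediateField F (AlgebraicClosure F)} (hK : K' ≤ maxUnramified F)
    (h2 : Module.finrank F K' = 2) {d : F} (hd : ¬ IsSquare d) {x : K'}
    (hx : x ^ 2 = algebraMap F K' d) : IsSquare (algebraMap F K' (-(E.c₄ / E.c₆))) := by
  haveI : FiniteDimensional F K' := Module.finite_of_finrank_eq_succ h2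
  obtain ⟨z, hz⟩ := IsAlgClosed.exists_pow_nat_eq
    (algebraMap F (AlgebraicClosure F) (-(E.c₄ / E.c₆))) two_pos
  have hzK : z ∈ K' :=
    mem_of_sq_eq_of_mem_maxUnramified hK hd hx (sqrt_gamma_mem_maxUnramified E hmult hz) hz
  refine ⟨⟨z, hzK⟩, Subtype.ext ?_⟩
  change algebraMap F (AlgebraicClosure F) (-(E.c₄ / E.c₆)) = z * z
  rw [← hz, pow_two]

end Gamma

end Literature.NumberTheory.EllipticCurves.Kramer1981

end
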